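import Literature.AlgebraicGeometry.KTheory.GrothendieckGroup
import Literature.AlgebraicGeometry.Deformation.VectorBundleExtensionObstruction
import Literature.AlgebraicGeometry.Crystalline.BlochEsnaultKerzLifting
import Mathlib.NumberTheory.Padics.PadicVal.Basic

/-!
# Sketch — crux-ideate `stmt-HodgeConjecture-13815` (`PadicPridhamSemiregularity`), ideator 1, round 1

First lemmas of the two idea cards, over EXISTING declarations only
(`KTheory.KZero`, `Deformation.VectorBundleExtensionObstruction`, `Motives.WittScheme`,
`Motives.CrystallineRealization`).

* Card A `sigma-ob-kzero-additivity`: `KZeroFactorizationPrinciple` (PROVED below) and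
  `ClassLiftDetection V` (PROVED below from the one analytic input, additivity (A1) of `σ ∘ ob`,
  taken as a hypothesis): the abstract skeleton of (⋆) CLASS-LIFTS-IMPLY-OBJECT-LIFTS is already a
  theorem; the line's only real lemma is (A1).
* Card B `absolute-atiyah-window-collapse`: `DividedPowerWindowCollapse` (arithmetic heart:
  `γ_j(pⁿ) = p^{nj}/j! ∈ p^{n+1} W` for `j ≥ 2`, `p` odd) and the typed OUTPUT shape
  `PadicBlochLifting C Semireg` (semiregular + Hodge condition + Hodge-torsion-free ⇒
  `LiftsFormally`, with `p > d` only; `Semireg` is the real p-adic semiregularity predicate, a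
  PARAMETER pending the σ-construction requested by the route).
-/

noncomputable section

open CategoryTheory AlgebraicGeometry
open Literature.AlgebraicGeometry.Motives Literature.AlgebraicGeometry.KTheory
  Literature.AlgebraicGeometry.Deformation

universe u

set_option linter.dupNamespace false

namespace Summit.HodgeConjecture.HodgeConjecture.Cruxes.PadicPridhamSemiregularity.IdeatorOne

/-! ## Card A — `σ ∘ ob` factors through `K₀` -/

/-- **K₀-FACTORIZATION PRINCIPLE** (card A, first lemma). For ANY morphism of schemes
`f : Y ⟶ Z` and any invariant `Φ` of vector bundles on `Y` with values in an abelian group which is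
(A1) additive on short exact sequences of vector bundles and (A2) vanishes on pull-backs `f^* G` of
vector bundles from `Z`: `Φ(F) = 0` for every vector bundle `F` on `Y` whose class
`[F] ∈ K₀(Y)` lies in the image of `f^* : K₀(Z) → K₀(Y)`. (Intended: `f = (X_{n+1} ↪ X_{n+2})`,
`Φ(F) = σ_{F|X₁}(ob(F))` = semiregularity map applied to Illusie's obstruction.) -/
def KZeroFactorizationPrinciple : Prop :=
  ∀ ⦃Y Z : Scheme.{u}⦄ (f : Y ⟶ Z) (A : Type u) [AddCommGroup A]
    (Φ : ∀ F : Y.Modules, IsFiniteLocallyFree F → A),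
    (∀ (S : ShortComplex Y.Modules), S.ShortExact → ∀ (h₁ : IsFiniteLocallyFree S.X₁)
      (h₂ : IsFiniteLocallyFree S.X₂) (h₃ : IsFiniteLocallyFree S.X₃),
        Φ S.X₂ h₂ = Φ S.X₁ h₁ + Φ S.X₃ h₃) →
    (∀ (G : Z.Modules) (hG : IsFiniteLocallyFree G),
      Φ ((Scheme.Modules.pullback f).obj G) (hG.pullback f) = 0) →
    ∀ (F : Y.Modules) (hF : IsFiniteLocallyFree F),
      (∃ y : KZero Z, KZero.map f y = KZero.of F hF) → Φ F hF = 0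

/-- The K₀-factorization principle holds (universal property of Fulton's `K⁰`, tree
`KZero.lift` / `KZero.hom_ext`). [folklore] -/
theorem kZeroFactorizationPrinciple : KZeroFactorizationPrinciple.{u} := by
  intro Y Z f A _ Φ hadd hvan F hF hy
  obtain ⟨y, hy⟩ := hy
  have hcomp : (KZero.lift Φ hadd).comp (KZero.map f) = 0 :=
    KZero.hom_ext fun G hG => by
      simp only [AddMonoidHom.comp_apply, KZero.map_of, KZero.lift_of, AddMonoidHom.zero_apply]
      exact hvan G hG
  have h1 : KZero.lift Φ hadd (KZero.of F hF) = Φ F hF := KZero.lift_of Φ hadd F hF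
  rw [← h1, ← hy, ← AddMonoidHom.comp_apply, hcomp, AddMonoidHom.zero_apply]

/-- **(⋆) FROM ADDITIVITY** (card A, second lemma). For an obstruction theory `V` of vector bundles
across first-order thickenings and a family of additive maps `σ_F : Ext²(F, F ⊗ 𝓘) → A` (intended:
the p-adic Buchweitz–Flenner semiregularity map of `F|X₁` after the "cher à Cartan" transport):
IF `F ↦ σ_F(ob(F))` is additive on short exact sequences of vector bundles on `Z₀` (the line's ONE
analytic lemma (A1), proved on paper by filtered Čech cocycles: `ob` and `At` of a filtered bundle
are block-upper-triangular and the trace of a block-triangular product is the sum of the traces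
of its diagonal blocks), THEN every `σ`-semiregular `F` (σ_F injective) whose K₀-class lifts
across `i` lifts as an OBJECT. With `i = (X_{n+1} ↪ X_{n+2})` this is hypothesis (⋆)
`ClassLiftsImplyObjectLifts` of the route item `FormalLiftingFromClassLifting`, i.e. CLAIM (ii′) of
the crux, with no torsion-freeness, no projectivity and no bound on `p` beyond `q! ∈ W×`. -/
def ClassLiftDetection (V : VectorBundleExtensionObstruction.{u}) : Prop :=
  ∀ ⦃Z₀ Z₁ : Scheme.{u}⦄ (i : Z₀ ⟶ Z₁) [IsFirstOrderThickening i] (A : Type u) [AddCommGroup A]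
    (σ : ∀ F : Z₀.Modules, IsFiniteLocallyFree F → (obstructionGroup 2 F (conormalSheaf i) →+ A)),
    (∀ (S : ShortComplex Z₀.Modules), S.ShortExact → ∀ (h₁ : IsFiniteLocallyFree S.X₁)
      (h₂ : IsFiniteLocallyFree S.X₂) (h₃ : IsFiniteLocallyFree S.X₃),
        σ S.X₂ h₂ (V.ob i S.X₂ h₂.isVectorBundle) =
          σ S.X₁ h₁ (V.ob i S.X₁ h₁.isVectorBundle) + σ S.X₃ h₃ (V.ob i S.X₃ h₃.isVectorBundle)) →
    ∀ (F : Z₀.Modules) (hF : IsFiniteLocallyFree F), Function.Injective (σ F hF) →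
      (∃ y : KZero Z₁, KZero.map i y = KZero.of F hF) → LiftsAlong i F

/-- `ClassLiftDetection V` holds for EVERY obstruction theory `V` (so no junk instance can dodge it):
K₀-factorization + `ob = 0 ↔ LiftsAlong` (Tag 08VR) + injectivity of `σ_F`. [folklore] -/
theorem classLiftDetection (V : VectorBundleExtensionObstruction.{u}) : ClassLiftDetection V := by
  intro Z₀ Z₁ i _ A _ σ hadd F hF hinj hy
  have hvan : ∀ (G : Z₁.Modules) (hG : IsFiniteLocallyFree G),
      σ _ (hG.pullback i)
        (V.ob i ((Scheme.Modules.pullback i).obj G) (hG.pullback i).isVectorBundle) = 0 := by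
    intro G hG
    have hlift : LiftsAlong i ((Scheme.Modules.pullback i).obj G) :=
      ⟨G, hG.isVectorBundle, ⟨Iso.refl _⟩⟩
    rw [(V.ob_eq_zero_iff i _ _).mpr hlift, map_zero]
  have h0 : σ F hF (V.ob i F hF.isVectorBundle) = 0 :=
    kZeroFactorizationPrinciple i A (fun F hF => σ F hF (V.ob i F hF.isVectorBundle)) hadd hvan
      F hF hy
  have hob : V.ob i F hF.isVectorBundle = 0 := hinj (by rw [h0, map_zero])
  exact (V.ob_eq_zero_iff i F hF.isVectorBundle).mp hob

/-! ## Card B — absolute Atiyah class over `W`, derived de Rham, window collapse -/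

/-- **DIVIDED-POWER WINDOW COLLAPSE** (card B, arithmetic heart). For an odd prime `p`, `n ≥ 1`
and `j ≥ 2` the divided power `γ_j(pⁿ) = p^{nj}/j!` lies in `p^{n+1} ℤ_{(p)}`, i.e.
`v_p(j!) + n + 1 ≤ n j`. Consequence: modulo `p^{n+1}` the `(pⁿ)`-PD Hodge filtration step
`Filʳ = [p^{nr}𝒪 → … → pⁿΩ^{r-1} → Ωʳ → …]` of `RΓ_cris(X_n/W) = RΓ_dR(𝒳̂/W)` retains only its
`j = 0, 1` pieces `Ω^{≥ r} ⊕ pⁿΩ^{r-1}`: the Bloch–Esnault–Kerz window of the level-`n → n+1`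
class obstruction collapses to its top piece `H^{r+1}(X₁, Ω^{r-1})` on refined Chern characters of
bundles that exist on `X_n` (p-adic Griffiths transversality). [folklore] -/
def DividedPowerWindowCollapse : Prop :=
  ∀ (p : ℕ), p.Prime → p ≠ 2 → ∀ (n j : ℕ), 1 ≤ n → 2 ≤ j →
    n + 1 + padicValNat p j.factorial ≤ n * j

/-- Small-case sanity check of the collapse inequality at `p = 3`, `n = 1`, `j = 3`
(`v₃(3!) = 1`, `1 + 1 + 1 ≤ 3`). [folklore] -/
example : (1 : ℕ) + 1 + padicValNat 3 (Nat.factorial 3) ≤ 1 * 3 := by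
  have h6 : Nat.factorial 3 = 3 * 2 := by decide
  have : padicValNat 3 (Nat.factorial 3) = 1 := by
    rw [h6, padicValNat.mul (by norm_num) (by norm_num), padicValNat.self (by norm_num)]
    have : padicValNat 3 2 = 0 := padicValNat.eq_zero_of_not_dvd (by norm_num)
    omega
  omega

/-- **p-ADIC BLOCH LIFTING** — the typed OUTPUT of line B (P1b♮ ⇒ `LiftsFormally` by induction on
the level, bypassing K₀ of the thickenings and the route item `FormalLiftingFromClassLifting`):
for `𝒳/W(k)` a smooth proper model of relative dimension `d < p` with `p`-torsion-free
`H^b(𝒳, 𝒪)` and `H^b(𝒳, Ω¹)` (the route's typing of Hodge-torsion-freeness), every finite locally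
free `E₁` on the special fibre which is p-ADICALLY SEMIREGULAR (`Semireg`, the real predicate
"⊕_{q<p} σ_q injective on `Ext²(E₁,E₁)`" — a PARAMETER here, pending the σ-construction requested
by the route; NOT quantified inside, so no re-decoration applies to THIS Prop) and satisfies the
Bloch–Esnault–Kerz Hodge condition lifts to a formal vector bundle. The Berthelot–Ogus line-bundle
theorem `BerthelotOgusLineBundleLifting C` is its rank-one case (`Semireg` automatic). -/
def PadicBlochLifting {p : ℕ} [Fact p.Prime] {k : Type} [Field k] [CharP k p] [PerfectRing k p]
    (C : CrystallineRealization p k)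
    (Semireg : ∀ 𝒳 : SchemeOver (WittVector p k), (WittScheme.specialFibre 𝒳).left.Modules → Prop) :
    Prop :=
  ∀ ⦃d : ℕ⦄ ⦃𝒳 : SchemeOver (WittVector p k)⦄, WittScheme.IsSmoothProperModel d 𝒳 → d < p →
    p ≠ 2 →
    (∀ (b : ℕ) (x : structureSheafCohomology 𝒳.left b), (p : ℤ) • x = 0 → x = 0) →
    (∀ (b : ℕ) (x : hodgeCohomologyOne 𝒳 b), (p : ℤ) • x = 0 → x = 0) →
    ∀ (E₁ : (WittScheme.specialFibre 𝒳).left.Modules), IsFiniteLocallyFree E₁ →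
      Semireg 𝒳 E₁ → C.HodgeCondition 𝒳 E₁ → WittScheme.LiftsFormally 𝒳 E₁

end Summit.HodgeConjecture.HodgeConjecture.Cruxes.PadicPridhamSemiregularity.IdeatorOne

end
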